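import Literature.NumberTheory.LFunctions.GRHTwistedCharacterPrimeSumsIdentity
import Literature.NumberTheory.LFunctions.GRHTwistedCharacterPrimeSumsAverages
import Literature.NumberTheory.LFunctions.LinnikZeroSumFromDensity
import HarnessLib

/-!
# Twisted character sums over prime (power)s in a window, from the explicit formula

Topic `Literature/NumberTheory/LFunctions`. THEOREMS only (no definition, no named fact, no `sorry`).

The standard route from the truncated explicit formula for `ψ(x, χ)` (Montgomery–Vaughan,
*Multiplicative Number Theory I*, Theorem 12.10; PROVED in the tree,
`Literature.NumberTheory.LFunctions.truncatedExplicitFormula_psiChar_holds`) to upper bounds for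
twisted sums over primes `p` in a WINDOW `x < p ≤ X`,
`∑_{x < p ≤ X} χ(p) p^{-it} log p` and `∑_{x < p ≤ X} χ(p) p^{1-it}`,
in terms of the zeros `ρ = β + iγ`, `|γ| ≤ T`, of `L(s, χ)` — the form in which Linnik-type
arguments (a zero-free strip `β ≤ 1 − η` up to height `T` plus the crude count `N(T, χ) ≪ T log T`)
are consumed, e.g. by Y. Zhang, arXiv:2211.02515, Lemma 5.6 (`Zhang2022/Section5PrimeSums.lean`).
Everything here is unconditional bookkeeping:

* `norm_cpow_sub_cpow_div_le` — `|(X^{ρ-it} − x^{ρ-it})/(ρ − it)| ≤ (X − x) x^{β−1}` for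
  `0 < x ≤ X`, `0 < β ≤ 1` (the integral `∫_x^X u^{ρ-1-it} du`).
* `norm_windowSum_vonMangoldt_le` — subtracting the tree's Abel-summed explicit formula
  (`GRHTwistedPrimeSum.norm_twistedSum_add_zeroSums_le`, MV Thm 12.10 + proof of Thm 13.7; no
  Riemann hypothesis is involved there) at `X` and at `x`:
  `‖∑_{x < n ≤ X} χ(n)Λ(n)n^{-it}‖ ≤ (X − x) ∑_{|γ| ≤ T} m(ρ) x^{β−1} + R(X) + R(x)`,
  `R(Y) = (2K+3) log Y + 2K(Y/T) log²(qYT) + |t|K(4Y log Y/((9/4)T)^{1/2} + Y log²(qYT)/T)`.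
* `zeroSum_le_of_strip` — if every zero of the box has `β ≤ 1 − η` then
  `∑ m(ρ) x^{β−1} ≤ x^{−η} ∑ m(ρ)` (`x ≥ 1`); the count `∑ m(ρ) ≤ C₀ T log T` is the tree's
  `Literature.NumberTheory.LFunctions.exists_boxCount_le` (MV Thm 10.17).
* `norm_windowSum_sub_primeSum_le` — prime powers: the window sum of `χ(n)Λ(n)n^{-it}` differs
  from `∑_{x < p ≤ X} χ(p) p^{-it} log p` by at most `ψ(X) − ϑ(X) ≤ 2 X^{1/2} log X` (Mathlib
  `Chebyshev.psi_sub_theta_le`).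
* `norm_sum_Ioc_mul_le_of_monotone` — discrete Abel summation with a non-decreasing non-negative
  weight `g`: `‖∑_{a < n ≤ b} c(n) g(n)‖ ≤ 2 M g(b)` if all partial sums `‖∑_{a < n ≤ u} c(n)‖ ≤ M`;
  `div_log_le_succ` — `n/log n` is non-decreasing for `n ≥ 3` (the weight turning `p^{-it} log p`
  into `p^{1-it}`).

## References

* H. L. Montgomery, R. C. Vaughan, *Multiplicative Number Theory I. Classical Theory*, CUP 2007,
  Theorems 10.17, 12.10, 13.7. [MontgomeryVaughan2007]
* E. Bombieri, *Le grand crible dans la théorie analytique des nombres*, Astérisque 18 (1987), §6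
  ("Preuve du Théorème de Linnik", p. 55: the zero sum against a zero-free strip).
  [Bombieri1987GrandCrible]
-/

noncomputable section

open Complex Filter Topology Set MeasureTheory intervalIntegral
open scoped Real ArithmeticFunction.vonMangoldt

namespace Literature.NumberTheory.LFunctions

namespace TwistedPrimeSumWindow

open DirichletCharacter ExplicitPsiChar GRHTwistedPrimeSum

/-! ### One zero across a window -/

/-- `‖(X^{ρ−it} − x^{ρ−it})/(ρ − it)‖ ≤ (X − x) x^{Re ρ − 1}` for `0 < x ≤ X`, `0 < Re ρ ≤ 1`
(write the quotient as `∫_x^X u^{ρ−1−it} du` and bound the integrand by `x^{Re ρ − 1}`).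
[folklore] -/
theorem norm_cpow_sub_cpow_div_le {ρ : ℂ} (hρ : 0 < ρ.re) (hρ1 : ρ.re ≤ 1) (t : ℝ) {x X : ℝ}
    (hx : 0 < x) (hxX : x ≤ X) :
    ‖((X : ℂ) ^ (ρ - t * I) - (x : ℂ) ^ (ρ - t * I)) / (ρ - t * I)‖ ≤ (X - x) * x ^ (ρ.re - 1) := by
  have hid := integral_zeroDeriv_mul_twist {ρ} (fun _ ↦ (1 : ℂ)) (by simpa using hρ) t hx hxX
  simp only [Finset.sum_singleton, one_mul] at hid
  rw [← hid]
  have hbound : ∀ u ∈ Set.uIoc x X, ‖(u : ℂ) ^ (ρ - 1) * (u : ℂ) ^ (-(t * I))‖ ≤ x ^ (ρ.re - 1) := by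
    intro u hu
    rw [uIoc_of_le hxX] at hu
    have hu0 : 0 < u := hx.trans hu.1
    rw [norm_mul, norm_cpow_twist hu0, mul_one, Complex.norm_cpow_eq_rpow_re_of_pos hu0,
      sub_re, one_re]
    exact Real.rpow_le_rpow_of_nonpos hx hu.1.le (by linarith)
  have h := intervalIntegral.norm_integral_le_of_norm_le_const hbound
  rw [abs_of_nonneg (by linarith : 0 ≤ X - x)] at h
  exact h.trans_eq (mul_comm _ _)

/-! ### The window form of the twisted explicit formula -/

/-- **Twisted sums over a window.** For a primitive `χ` mod `q > 1`, a real `t`, `T ≥ 2` and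
`3 ≤ x ≤ X`,
`‖∑_{x < n ≤ X} χ(n)Λ(n) n^{-it}‖ ≤ (X − x) ∑_{ρ, |γ| ≤ T} m(ρ) x^{Re ρ − 1} + R(X) + R(x)`,
`R(Y) = (2K+3) log Y + 2K (Y/T) log²(qYT) + |t| K (4Y log Y/√((9/4)T) + Y log²(qYT)/T)`, `K` the
constant of the truncated explicit formula (hypothesis `hEF`, supplied by
`truncatedExplicitFormula_psiChar_holds`). Proof: subtract
`GRHTwistedPrimeSum.norm_twistedSum_add_zeroSums_le` (with `c = 9/4`) at `X` and at `x`; the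
difference of the zero sums is `∑ m(ρ)(X^{ρ−it} − x^{ρ−it})/(ρ − it)`, bounded termwise by
`norm_cpow_sub_cpow_div_le`. [cite: MontgomeryVaughan2007, Theorem 12.10, proof of Theorem 13.7] -/
theorem norm_windowSum_vonMangoldt_le {K : ℝ} (hK0 : 0 ≤ K)
    (hEF : ∀ (q : ℕ) [NeZero q], 1 < q → ∀ χ : DirichletCharacter ℂ q, χ.IsPrimitive →
      ∀ x : ℝ, 2 ≤ x → ∀ T : ℝ, 2 ≤ T →
        ‖chebyshevPsiChar₀ χ x - (-charZeroSumTrunc χ x T - 1 / 2 * Real.log (x - 1) -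
            χ (-1) / 2 * Real.log (x + 1) + explicitFormulaConst χ)‖ ≤
          K * (Real.log x * min 1 (x / (T * primePowDist x)) + x / T * Real.log (q * x * T) ^ 2))
    {q : ℕ} [NeZero q] {χ : DirichletCharacter ℂ q} (hprim : χ.IsPrimitive) (hq : 1 < q)
    (t : ℝ) {x X T : ℝ} (hx : 3 ≤ x) (hxX : x ≤ X) (hT : 2 ≤ T) :
    ‖∑ n ∈ Finset.Ioc ⌊x⌋₊ ⌊X⌋₊, χ n * Λ n * (n : ℂ) ^ (-(t * I))‖ ≤
      (X - x) * ∑ ρ ∈ (lfunctionZeroBox_finite (ne_one_of_isPrimitive hprim hq) T).toFinset,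
          (DirichletDisc.zeroOrder χ ρ : ℝ) * x ^ (ρ.re - 1) +
      ((2 * K + 3) * Real.log X + 2 * K * (X / T) * Real.log (q * X * T) ^ 2 +
        |t| * K * (4 * X * Real.log X / Real.sqrt (9 / 4 * T) + X * Real.log (q * X * T) ^ 2 / T)) +
      ((2 * K + 3) * Real.log x + 2 * K * (x / T) * Real.log (q * x * T) ^ 2 +
        |t| * K * (4 * x * Real.log x / Real.sqrt (9 / 4 * T) + x * Real.log (q * x * T) ^ 2 / T)) := by
  classical
  have hχ : χ ≠ 1 := ne_one_of_isPrimitive hprim hq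
  set P := (lfunctionZeroBox_finite hχ T).toFinset with hPdef
  have hP : ∀ ρ ∈ P, χ.LFunction ρ = 0 ∧ 0 < ρ.re ∧ ρ.re < 1 ∧ |ρ.im| ≤ T := fun ρ hρ ↦ by
    simpa [hPdef, mem_lfunctionZeroBox] using hρ
  have hX3 : 3 ≤ X := hx.trans hxX
  have hx0 : 0 < x := by linarith
  have h1 := norm_twistedSum_add_zeroSums_le hK0 hEF hprim hq t (c := 9 / 4) le_rfl
    (by norm_num) hX3 hT
  have h2 := norm_twistedSum_add_zeroSums_le hK0 hEF hprim hq t (c := 9 / 4) le_rfl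
    (by norm_num) hx hT
  set S : ℝ → ℂ := fun Y ↦ ∑ n ∈ Finset.Ioc 2 ⌊Y⌋₊, χ n * Λ n * (n : ℂ) ^ (-(t * I)) with hS
  set Z : ℝ → ℂ := fun Y ↦ ∑ ρ ∈ P, (DirichletDisc.zeroOrder χ ρ : ℂ) *
      (((Y : ℂ) ^ (ρ - t * I) - ((9 / 4 : ℝ) : ℂ) ^ (ρ - t * I)) / (ρ - t * I)) with hZ
  change ‖S X + Z X‖ ≤ _ at h1
  change ‖S x + Z x‖ ≤ _ at h2
  -- the window sum and the difference of the zero sums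
  have hfl : ⌊x⌋₊ ≤ ⌊X⌋₊ := Nat.floor_le_floor hxX
  have hfl2 : 2 ≤ ⌊x⌋₊ := Nat.le_floor (by norm_num; linarith)
  have hwin : S X - S x = ∑ n ∈ Finset.Ioc ⌊x⌋₊ ⌊X⌋₊, χ n * Λ n * (n : ℂ) ^ (-(t * I)) := by
    rw [hS]; dsimp only
    rw [← Finset.sum_Ioc_consecutive _ hfl2 hfl]; ring
  set W : ℂ := ∑ ρ ∈ P, (DirichletDisc.zeroOrder χ ρ : ℂ) *
      (((X : ℂ) ^ (ρ - t * I) - (x : ℂ) ^ (ρ - t * I)) / (ρ - t * I)) with hW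
  have hZd : Z X - Z x = W := by
    rw [hZ, hW]; dsimp only
    rw [← Finset.sum_sub_distrib]
    refine Finset.sum_congr rfl fun ρ _ ↦ ?_
    ring
  have hWle : ‖W‖ ≤ (X - x) * ∑ ρ ∈ P, (DirichletDisc.zeroOrder χ ρ : ℝ) * x ^ (ρ.re - 1) := by
    rw [hW, Finset.mul_sum]
    refine (norm_sum_le _ _).trans (Finset.sum_le_sum fun ρ hρ ↦ ?_)
    rw [norm_mul, Complex.norm_natCast]
    have hb := norm_cpow_sub_cpow_div_le (hP ρ hρ).2.1 (hP ρ hρ).2.2.1.le t hx0 hxX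
    have hm : (0 : ℝ) ≤ DirichletDisc.zeroOrder χ ρ := Nat.cast_nonneg _
    calc (DirichletDisc.zeroOrder χ ρ : ℝ) * ‖((X : ℂ) ^ (ρ - t * I) - (x : ℂ) ^ (ρ - t * I)) /
          (ρ - t * I)‖ ≤ (DirichletDisc.zeroOrder χ ρ : ℝ) * ((X - x) * x ^ (ρ.re - 1)) :=
          mul_le_mul_of_nonneg_left hb hm
      _ = (X - x) * ((DirichletDisc.zeroOrder χ ρ : ℝ) * x ^ (ρ.re - 1)) := by ring
  have hkey : ∑ n ∈ Finset.Ioc ⌊x⌋₊ ⌊X⌋₊, χ n * Λ n * (n : ℂ) ^ (-(t * I)) =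
      (S X + Z X) - (S x + Z x) - W := by
    rw [← hwin, ← hZd]; ring
  rw [hkey]
  calc ‖(S X + Z X) - (S x + Z x) - W‖ ≤ ‖(S X + Z X) - (S x + Z x)‖ + ‖W‖ := norm_sub_le _ _
    _ ≤ ‖S X + Z X‖ + ‖S x + Z x‖ + ‖W‖ := by
        have := norm_sub_le (S X + Z X) (S x + Z x); linarith
    _ ≤ _ := by linarith [h1, h2, hWle]

/-! ### The zero sum against a zero-free strip -/

/-- If every non-trivial zero `ρ` of `L(s, χ)` with `|Im ρ| ≤ T` has `Re ρ ≤ 1 − η`, then for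
`x ≥ 1`, `∑_{|γ| ≤ T} m(ρ) x^{Re ρ − 1} ≤ x^{−η} ∑_{|γ| ≤ T} m(ρ)`.
[cite: Bombieri1987GrandCrible, §6 p. 55] -/
theorem zeroSum_le_of_strip {q : ℕ} [NeZero q] {χ : DirichletCharacter ℂ q} (hχ : χ ≠ 1)
    {T η x : ℝ} (hx : 1 ≤ x) (hη : ∀ ρ ∈ lfunctionZeroBox χ T, ρ.re ≤ 1 - η) :
    ∑ ρ ∈ (lfunctionZeroBox_finite hχ T).toFinset, (DirichletDisc.zeroOrder χ ρ : ℝ) * x ^ (ρ.re - 1)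
      ≤ x ^ (-η) * ∑ ρ ∈ (lfunctionZeroBox_finite hχ T).toFinset, (DirichletDisc.zeroOrder χ ρ : ℝ) := by
  rw [Finset.mul_sum]
  refine Finset.sum_le_sum fun ρ hρ ↦ ?_
  have hρ' : ρ ∈ lfunctionZeroBox χ T := by simpa using hρ
  have hle : x ^ (ρ.re - 1) ≤ x ^ (-η) :=
    Real.rpow_le_rpow_of_exponent_le hx (by linarith [hη ρ hρ'])
  have hm : (0 : ℝ) ≤ DirichletDisc.zeroOrder χ ρ := Nat.cast_nonneg _
  calc (DirichletDisc.zeroOrder χ ρ : ℝ) * x ^ (ρ.re - 1)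
      ≤ (DirichletDisc.zeroOrder χ ρ : ℝ) * x ^ (-η) := mul_le_mul_of_nonneg_left hle hm
    _ = x ^ (-η) * (DirichletDisc.zeroOrder χ ρ : ℝ) := mul_comm _ _

/-- The strip bound combined with the crude count `N(T, χ) ≤ C₀ T log T`
(`Literature.NumberTheory.LFunctions.exists_boxCount_le`): for primitive `χ` mod `q > 1`,
`T ≥ 6`, `q ≤ T`, `x ≥ 1` and a zero-free strip `Re ρ ≤ 1 − η` up to height `T`,
`∑_{|γ| ≤ T} m(ρ) x^{Re ρ − 1} ≤ C₀ T (log T) x^{−η}`.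
[cite: MontgomeryVaughan2007, Theorem 10.17] [cite: Bombieri1987GrandCrible, §6 p. 55] -/
theorem exists_zeroSum_le_of_strip :
    ∃ C₀ : ℝ, 0 < C₀ ∧ ∀ (q : ℕ) [NeZero q] (χ : DirichletCharacter ℂ q) (hprim : χ.IsPrimitive)
      (hq : 1 < q), ∀ T : ℝ, 6 ≤ T → (q : ℝ) ≤ T → ∀ η x : ℝ, 1 ≤ x →
      (∀ ρ ∈ lfunctionZeroBox χ T, ρ.re ≤ 1 - η) →
        ∑ ρ ∈ (lfunctionZeroBox_finite (ne_one_of_isPrimitive hprim hq) T).toFinset,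
          (DirichletDisc.zeroOrder χ ρ : ℝ) * x ^ (ρ.re - 1) ≤ C₀ * T * Real.log T * x ^ (-η) := by
  obtain ⟨C₀, hC₀, H⟩ := exists_boxCount_le
  refine ⟨C₀, hC₀, fun q _ χ hprim hq T hT hqT η x hx hstrip ↦ ?_⟩
  have hχ : χ ≠ 1 := ne_one_of_isPrimitive hprim hq
  have hcount := H q χ hprim hq T hT hqT (lfunctionZeroBox_finite hχ T).toFinset
    (fun ρ hρ ↦ by simpa using hρ)
  have hxη : 0 ≤ x ^ (-η) := Real.rpow_nonneg (by linarith) _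
  calc _ ≤ x ^ (-η) * ∑ ρ ∈ (lfunctionZeroBox_finite hχ T).toFinset,
        (DirichletDisc.zeroOrder χ ρ : ℝ) := zeroSum_le_of_strip hχ hx hstrip
    _ ≤ x ^ (-η) * (C₀ * T * Real.log T) := mul_le_mul_of_nonneg_left hcount hxη
    _ = C₀ * T * Real.log T * x ^ (-η) := by ring

/-! ### Prime powers in a window -/

/-- The window sum over prime powers versus the sum over primes: for `a ≤ b`, `1 ≤ b`,
`‖∑_{a < n ≤ b} χ(n)Λ(n)n^{-it} − ∑_{a < p ≤ b} χ(p) p^{-it} log p‖ ≤ ψ(b) − ϑ(b) ≤ 2 √b log b`.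
[cite: MontgomeryVaughan2007, Theorem 13.7 (13.20)] -/
theorem norm_windowSum_sub_primeSum_le {q : ℕ} (χ : DirichletCharacter ℂ q) (t : ℝ) {a b : ℕ}
    (hb : 1 ≤ b) :
    ‖∑ n ∈ Finset.Ioc a b, χ n * Λ n * (n : ℂ) ^ (-(t * I)) -
        ∑ p ∈ (Finset.Ioc a b).filter Nat.Prime, χ p * (p : ℂ) ^ (-(t * I)) * (Real.log p : ℂ)‖ ≤
      2 * Real.sqrt b * Real.log b := by
  classical
  have hsplit := (Finset.sum_filter_add_sum_filter_not (Finset.Ioc a b) Nat.Prime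
    (fun n ↦ χ n * Λ n * (n : ℂ) ^ (-(t * I)))).symm
  have hprime : ∑ n ∈ (Finset.Ioc a b).filter Nat.Prime, χ n * Λ n * (n : ℂ) ^ (-(t * I)) =
      ∑ p ∈ (Finset.Ioc a b).filter Nat.Prime, χ p * (p : ℂ) ^ (-(t * I)) * (Real.log p : ℂ) := by
    refine Finset.sum_congr rfl fun p hp ↦ ?_
    rw [ArithmeticFunction.vonMangoldt_apply_prime (Finset.mem_filter.1 hp).2]; ring
  have hpsi : Chebyshev.psi b - Chebyshev.theta b =
      ∑ n ∈ (Finset.Icc 0 b).filter (fun n ↦ ¬n.Prime), (Λ n : ℝ) := by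
    rw [Chebyshev.psi_eq_sum_Icc, Chebyshev.theta_eq_sum_Icc, Nat.floor_natCast, Finset.sum_filter,
      Finset.sum_filter, ← Finset.sum_sub_distrib]
    refine Finset.sum_congr rfl fun n _ ↦ ?_
    split_ifs with h
    · simp [ArithmeticFunction.vonMangoldt_apply_prime h]
    · simp
  rw [hsplit, hprime, add_sub_cancel_left]
  have hb1 : (1 : ℝ) ≤ b := by exact_mod_cast hb
  have hsub : (Finset.Ioc a b).filter (fun n ↦ ¬n.Prime) ⊆ (Finset.Icc 0 b).filter (fun n ↦ ¬n.Prime) :=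
    Finset.filter_subset_filter _ fun n hn ↦ by
      rw [Finset.mem_Ioc] at hn; rw [Finset.mem_Icc]; omega
  calc ‖∑ n ∈ (Finset.Ioc a b).filter (fun n ↦ ¬n.Prime), χ n * Λ n * (n : ℂ) ^ (-(t * I))‖
      ≤ ∑ n ∈ (Finset.Ioc a b).filter (fun n ↦ ¬n.Prime), ‖χ n * Λ n * (n : ℂ) ^ (-(t * I))‖ :=
        norm_sum_le _ _
    _ ≤ ∑ n ∈ (Finset.Ioc a b).filter (fun n ↦ ¬n.Prime), (Λ n : ℝ) :=
        Finset.sum_le_sum fun n _ ↦ norm_twistTerm_le χ t n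
    _ ≤ ∑ n ∈ (Finset.Icc 0 b).filter (fun n ↦ ¬n.Prime), (Λ n : ℝ) :=
        Finset.sum_le_sum_of_subset_of_nonneg hsub fun n _ _ ↦ ArithmeticFunction.vonMangoldt_nonneg
    _ = Chebyshev.psi b - Chebyshev.theta b := hpsi.symm
    _ ≤ 2 * Real.sqrt b * Real.log b := Chebyshev.psi_sub_theta_le hb1

/-! ### Discrete Abel summation with a monotone weight -/

/-- **Discrete Abel summation, monotone non-negative weight.** If `0 ≤ g(n) ≤ g(n+1)` for
`n > a` and `‖∑_{a < n ≤ u} c(n)‖ ≤ M` for all `a ≤ u ≤ b`, then for `a < b`,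
`‖∑_{a < n ≤ b} c(n) g(n)‖ ≤ 2 M g(b)`
(`∑ c g = A(b)g(b) − ∑_{a < n < b} A(n)(g(n+1) − g(n))`). [folklore] -/
theorem norm_sum_Ioc_mul_le_of_monotone {c : ℕ → ℂ} {g : ℕ → ℝ} {a b : ℕ} {M : ℝ}
    (hg0 : ∀ n, a < n → 0 ≤ g n) (hmono : ∀ n, a < n → g n ≤ g (n + 1))
    (hA : ∀ u, a ≤ u → u ≤ b → ‖∑ n ∈ Finset.Ioc a u, c n‖ ≤ M) (hab : a < b) :
    ‖∑ n ∈ Finset.Ioc a b, c n * (g n : ℂ)‖ ≤ 2 * M * g b := by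
  have hM : 0 ≤ M := by simpa using hA a le_rfl hab.le
  -- `‖∑_{a<n≤k} c g − A(k) g(k)‖ ≤ M (g k − g (a+1))` for `a + 1 ≤ k ≤ b`
  have key : ∀ k, a + 1 ≤ k → k ≤ b →
      ‖∑ n ∈ Finset.Ioc a k, c n * (g n : ℂ) - (∑ n ∈ Finset.Ioc a k, c n) * (g k : ℂ)‖ ≤
        M * (g k - g (a + 1)) := by
    intro k hk
    induction k, hk using Nat.le_induction with
    | base =>
        intro _
        have : Finset.Ioc a (a + 1) = {a + 1} := by
          ext n; simp only [Finset.mem_Ioc, Finset.mem_singleton]; omega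
        simp [this]
    | succ k hk ih =>
        intro hkb
        have ih' := ih (by omega)
        have hak : a ≤ k := by omega
        rw [Finset.sum_Ioc_succ_top hak, Finset.sum_Ioc_succ_top hak]
        have e : (∑ n ∈ Finset.Ioc a k, c n * (g n : ℂ)) + c (k + 1) * (g (k + 1) : ℂ) -
            ((∑ n ∈ Finset.Ioc a k, c n) + c (k + 1)) * (g (k + 1) : ℂ) =
            (∑ n ∈ Finset.Ioc a k, c n * (g n : ℂ) - (∑ n ∈ Finset.Ioc a k, c n) * (g k : ℂ)) -
              (∑ n ∈ Finset.Ioc a k, c n) * (((g (k + 1) - g k : ℝ)) : ℂ) := by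
          push_cast; ring
        rw [e]
        have hAk : ‖∑ n ∈ Finset.Ioc a k, c n‖ ≤ M := hA k hak (by omega)
        have hgk : g k ≤ g (k + 1) := hmono k (by omega)
        have h2 : ‖(∑ n ∈ Finset.Ioc a k, c n) * (((g (k + 1) - g k : ℝ)) : ℂ)‖ ≤
            M * (g (k + 1) - g k) := by
          rw [norm_mul, Complex.norm_real, Real.norm_of_nonneg (by linarith)]
          exact mul_le_mul_of_nonneg_right hAk (by linarith)
        calc _ ≤ ‖∑ n ∈ Finset.Ioc a k, c n * (g n : ℂ) - (∑ n ∈ Finset.Ioc a k, c n) * (g k : ℂ)‖ +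
              ‖(∑ n ∈ Finset.Ioc a k, c n) * (((g (k + 1) - g k : ℝ)) : ℂ)‖ := norm_sub_le _ _
          _ ≤ M * (g k - g (a + 1)) + M * (g (k + 1) - g k) := add_le_add ih' h2
          _ = M * (g (k + 1) - g (a + 1)) := by ring
  have hk := key b hab le_rfl
  have hAb : ‖(∑ n ∈ Finset.Ioc a b, c n) * (g b : ℂ)‖ ≤ M * g b := by
    rw [norm_mul, Complex.norm_real, Real.norm_of_nonneg (hg0 b hab)]
    exact mul_le_mul_of_nonneg_right (hA b hab.le le_rfl) (hg0 b hab)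
  have hga : 0 ≤ g (a + 1) := hg0 (a + 1) (by omega)
  have e := norm_add_le
    (∑ n ∈ Finset.Ioc a b, c n * (g n : ℂ) - (∑ n ∈ Finset.Ioc a b, c n) * (g b : ℂ))
    ((∑ n ∈ Finset.Ioc a b, c n) * (g b : ℂ))
  rw [sub_add_cancel] at e
  nlinarith

/-- `n/log n ≤ (n+1)/log(n+1)` for `n ≥ 3` (`log(1 + 1/n) ≤ 1/n` and `log n ≥ log 3 > 1`).
[folklore] -/
theorem div_log_le_succ {n : ℕ} (hn : 3 ≤ n) :
    (n : ℝ) / Real.log n ≤ ((n : ℝ) + 1) / Real.log ((n : ℝ) + 1) := by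
  have hn3 : (3 : ℝ) ≤ n := by exact_mod_cast hn
  have hn0 : (0 : ℝ) < n := by linarith
  have hlog3 : 1 < Real.log 3 := by
    rw [Real.lt_log_iff_exp_lt (by norm_num)]
    linarith [Real.exp_one_lt_d9]
  have hlogn : 1 < Real.log n := hlog3.trans_le (Real.log_le_log (by norm_num) hn3)
  have hlogn1 : Real.log n ≤ Real.log (n + 1) := Real.log_le_log hn0 (by linarith)
  have hdiff : Real.log (n + 1) - Real.log n ≤ 1 / n := by
    rw [← Real.log_div (by linarith) hn0.ne']
    have : ((n : ℝ) + 1) / n = 1 + 1 / n := by field_simp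
    rw [this]
    linarith [Real.log_le_sub_one_of_pos (show (0 : ℝ) < 1 + 1 / n by positivity)]
  rw [div_le_div_iff₀ (by linarith) (by linarith)]
  -- `n log(n+1) ≤ n log n + 1 ≤ (n + 1) log n`
  have h1 : (n : ℝ) * (Real.log (n + 1) - Real.log n) ≤ 1 := by
    calc (n : ℝ) * (Real.log (n + 1) - Real.log n) ≤ n * (1 / n) :=
          mul_le_mul_of_nonneg_left hdiff hn0.le
      _ = 1 := by field_simp
  nlinarith

end TwistedPrimeSumWindow

end Literature.NumberTheory.LFunctions

end
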